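import Literature.Algebra.Homology.TotalQuasiIsoOfColumns
import Mathlib.Algebra.Homology.TotalComplexSymmetry
import Mathlib.Algebra.Homology.Embedding.StupidTrunc
import Mathlib.Algebra.Homology.Embedding.HomEquiv
import HarnessLib

/-!
# Column-wise (or row-wise) quasi-isomorphisms of first-quadrant bicomplexes induce quasi-isomorphisms of total
# complexes

Layer `Literature/Algebra/Homology` (pure homological algebra over Mathlib; 0 named facts, no `def`, no instances).
Sequel to `Algebra/Homology/TotalQuasiIsoOfColumns` (the case of FINITELY many columns). Here the number of columns
is arbitrary but the bicomplexes are «first quadrant»: for `K L : HomologicalComplex₂ C (up ℤ) (up ℤ)` (complexes of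
COLUMNS `K.X p`) with no columns below `p₀` (`CochainComplex.IsStrictlyGE K p₀`) and EVERY column concentrated in
degrees `≥ a'` (ONE bound for all columns — the statement fails without it), and `φ : K ⟶ L`:

* §2 **`quasiIso_total_map_of_quasiIso_columns_of_isStrictlyGE`** — if every column `φ.f p` is a quasi-isomorphism,
  `Tot(φ) = HomologicalComplex₂.total.map φ (up ℤ)` is a quasi-isomorphism. Degree by degree: for `Hⁿ` only the
  columns `p ≤ d := n + 1 - a'` matter; the projections `K ⟶ σ^{≤ d} K` onto Mathlib's stupid truncation
  (`HomologicalComplex.stupidTrunc`, the projection being `Embedding.liftExtend` of the identity of the restriction —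
  `hasLift_id_restriction`, `isIso_liftExtend_id_f`, `liftExtend_id_naturality`) induce maps of total complexes
  that are isomorphisms in degrees `≤ n + 1` (`isIso_total_map_f_of_isIso`, `quasiIsoAt_of_isIso_f`), and
  `σ^{≤ d} φ` has finitely many columns (`TotalQuasiIsoOfColumns.quasiIso_total_map_of_quasiIso_columns`);
* §3 **`quasiIso_total_map_of_quasiIso_rows_of_isStrictlyGE`** — the same conclusion when every ROW
  `(flip φ).f q` is a quasi-isomorphism (same first-quadrant hypotheses), by flipping: `total_map_flip_comm` is the
  naturality of Mathlib's `totalFlipIso`. This is the form needed for the augmentation `I• → Tot Č(𝓤, I•)` of a Čech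
  bicomplex of a bounded-below complex with exact (augmented) rows; the column form serves
  `Tot ⊕ (u_s)_*(~) → Tot Č`.

Typed as the totalisation bricks of the Čech route to `D⁺(QCoh) ≃ D⁺_qc(Mod)` (Hartshorne RD II 7.19) sized in the
cell `pub-hodge-ring2`; research route conditional on HC_CM, not a corollary — nothing here refers to it.

## References

* C. A. Weibel, *An introduction to homological algebra* (1994), 1.2.6–1.2.8 (total complex, truncations),
  Thm. 1.3.1, 2.7.3 (acyclic assembly), 5.6.1–5.6.2 (double complexes). [Weibel1994]
* The Stacks Project, Tag 012Z (total complex), Tag 0133 (acyclic double complexes). [StacksProject]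
-/

noncomputable section

-- `GradedObject`/`HomologicalComplex₂.toGradedObject` are not reducible (as in Mathlib's `Algebra/Homology/TotalComplex.lean`).
set_option backward.isDefEq.respectTransparency false

open CategoryTheory CategoryTheory.Category CategoryTheory.Limits HomologicalComplex

universe v u

namespace Literature.Algebra.Homology

variable {C : Type u} [Category.{v} C] [Abelian C]
  [∀ K : HomologicalComplex₂ C (ComplexShape.up ℤ) (ComplexShape.up ℤ), K.HasTotal (ComplexShape.up ℤ)]

/-! ### §1 Degreewise tools -/

/-- `Tot(ψ)` is an isomorphism in total degree `m` if `ψ` is an isomorphism on every summand `(p, q)`, `p + q = m`.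
[cite: Weibel1994, 1.2.6 (total complex)] -/
theorem isIso_total_map_f_of_isIso {K L : HomologicalComplex₂ C (ComplexShape.up ℤ) (ComplexShape.up ℤ)} (ψ : K ⟶ L)
    (m : ℤ) (h : ∀ p q : ℤ, p + q = m → IsIso ((ψ.f p).f q)) :
    IsIso ((HomologicalComplex₂.total.map ψ (ComplexShape.up ℤ)).f m) := by
  refine ⟨⟨L.totalDesc fun p q hpq => by
    haveI := h p q hpq
    exact inv ((ψ.f p).f q) ≫ K.ιTotal (ComplexShape.up ℤ) p q m hpq, ?_, ?_⟩⟩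
  · refine HomologicalComplex₂.total.hom_ext _ fun p q hpq => ?_
    haveI := h p q hpq
    rw [HomologicalComplex₂.ιTotal_map_assoc, HomologicalComplex₂.ι_totalDesc, IsIso.hom_inv_id_assoc, comp_id]
  · refine HomologicalComplex₂.total.hom_ext _ fun p q hpq => ?_
    haveI := h p q hpq
    rw [HomologicalComplex₂.ι_totalDesc_assoc, Category.assoc, HomologicalComplex₂.ιTotal_map, IsIso.inv_hom_id_assoc,
      comp_id]

omit [∀ K : HomologicalComplex₂ C (ComplexShape.up ℤ) (ComplexShape.up ℤ), K.HasTotal (ComplexShape.up ℤ)] in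
/-- A cochain map which is an isomorphism in degrees `n - 1`, `n`, `n + 1` is a quasi-isomorphism in degree `n`.
[cite: Weibel1994, 1.1 and Thm. 1.3.1] -/
theorem quasiIsoAt_of_isIso_f {A B : CochainComplex C ℤ} (u : A ⟶ B) (n : ℤ) (h₁ : IsIso (u.f (n - 1)))
    (h₂ : IsIso (u.f n)) (h₃ : IsIso (u.f (n + 1))) : QuasiIsoAt u n := by
  rw [quasiIsoAt_iff' u (n - 1) n (n + 1) (by simp) (by simp)]
  haveI : Epi ((shortComplexFunctor' C (ComplexShape.up ℤ) (n - 1) n (n + 1)).map u).τ₁ := by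
    change Epi (u.f (n - 1)); infer_instance
  haveI : IsIso ((shortComplexFunctor' C (ComplexShape.up ℤ) (n - 1) n (n + 1)).map u).τ₂ := by
    change IsIso (u.f n); infer_instance
  haveI : Mono ((shortComplexFunctor' C (ComplexShape.up ℤ) (n - 1) n (n + 1)).map u).τ₃ := by
    change Mono (u.f (n + 1)); infer_instance
  exact ShortComplex.quasiIso_of_epi_of_isIso_of_mono _

omit [∀ K : HomologicalComplex₂ C (ComplexShape.up ℤ) (ComplexShape.up ℤ), K.HasTotal (ComplexShape.up ℤ)] in
/-- Transfer of `QuasiIsoAt` across a commutative square `f ≫ v = u ≫ f'` whose vertical maps `u`, `v` and bottom map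
`f'` are quasi-isomorphisms in degree `n`. [cite: Weibel1994, 1.1] -/
theorem quasiIsoAt_of_square {A B A' B' : CochainComplex C ℤ} (f : A ⟶ B) (f' : A' ⟶ B') (u : A ⟶ A') (v : B ⟶ B')
    (w : f ≫ v = u ≫ f') (n : ℤ) [QuasiIsoAt u n] [QuasiIsoAt v n] [QuasiIsoAt f' n] : QuasiIsoAt f n := by
  haveI : QuasiIsoAt (f ≫ v) n := by rw [w]; infer_instance
  exact quasiIsoAt_of_comp_right f v n

/-! ### §2 Cutting off the columns beyond `d` (Mathlib's stupid truncation, with its projection) -/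

omit [∀ K : HomologicalComplex₂ C (ComplexShape.up ℤ) (ComplexShape.up ℤ), K.HasTotal (ComplexShape.up ℤ)] in
/-- The identity of `K|_{≤ d}` lifts to the projection `K ⟶ σ^{≤ d} K` (no boundary condition for a `≤`-truncation).
[cite: Weibel1994, 1.2.7 (brutal truncations)] -/
theorem hasLift_id_restriction (K : HomologicalComplex₂ C (ComplexShape.up ℤ) (ComplexShape.up ℤ)) (d : ℤ) :
    (ComplexShape.embeddingUpIntLE d).HasLift (𝟙 (K.restriction (ComplexShape.embeddingUpIntLE d))) :=
  fun _ hj _ _ => (hj.false_of_isTruncLE).elim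

omit [∀ K : HomologicalComplex₂ C (ComplexShape.up ℤ) (ComplexShape.up ℤ), K.HasTotal (ComplexShape.up ℤ)] in
/-- The projection `K ⟶ σ^{≤ d} K` is an isomorphism on the columns `p ≤ d`. [cite: Weibel1994, 1.2.7] -/
theorem isIso_liftExtend_id_f (K : HomologicalComplex₂ C (ComplexShape.up ℤ) (ComplexShape.up ℤ)) (d p : ℤ) (hp : p ≤ d) :
    IsIso (((ComplexShape.embeddingUpIntLE d).liftExtend (𝟙 (K.restriction (ComplexShape.embeddingUpIntLE d)))
      (hasLift_id_restriction K d)).f p) := by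
  rw [(ComplexShape.embeddingUpIntLE d).isIso_liftExtend_f_iff _ _ (i := (d - p).toNat) (by simp; omega)]
  infer_instance

omit [∀ K : HomologicalComplex₂ C (ComplexShape.up ℤ) (ComplexShape.up ℤ), K.HasTotal (ComplexShape.up ℤ)] in
/-- Beyond `d` the columns of `σ^{≤ d} K` are zero objects. [cite: Weibel1994, 1.2.7] -/
theorem isZero_stupidTrunc_X_of_lt (K : HomologicalComplex₂ C (ComplexShape.up ℤ) (ComplexShape.up ℤ)) (d p : ℤ)
    (hp : d < p) : IsZero ((K.stupidTrunc (ComplexShape.embeddingUpIntLE d)).X p) :=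
  K.isZero_stupidTrunc_X _ p ((ComplexShape.notMem_range_embeddingUpIntLE_iff d p).2 hp)

omit [∀ K : HomologicalComplex₂ C (ComplexShape.up ℤ) (ComplexShape.up ℤ), K.HasTotal (ComplexShape.up ℤ)] in
/-- **Naturality of the projection `K ⟶ σ^{≤ d} K`** with respect to Mathlib's `stupidTruncMap`.
[cite: Weibel1994, 1.2.7 (brutal truncations)] -/
theorem liftExtend_id_naturality {K L : HomologicalComplex₂ C (ComplexShape.up ℤ) (ComplexShape.up ℤ)} (φ : K ⟶ L)
    (d : ℤ) :
    (ComplexShape.embeddingUpIntLE d).liftExtend (𝟙 (K.restriction (ComplexShape.embeddingUpIntLE d)))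
        (hasLift_id_restriction K d) ≫ stupidTruncMap φ (ComplexShape.embeddingUpIntLE d) =
      φ ≫ (ComplexShape.embeddingUpIntLE d).liftExtend (𝟙 (L.restriction (ComplexShape.embeddingUpIntLE d)))
        (hasLift_id_restriction L d) := by
  ext p : 1
  by_cases hp : p ≤ d
  · have hi : (ComplexShape.embeddingUpIntLE d).f (d - p).toNat = p := by simp; omega
    rw [comp_f, comp_f, (ComplexShape.embeddingUpIntLE d).liftExtend_f _ _ hi,
      (ComplexShape.embeddingUpIntLE d).liftExtend_f _ _ hi, id_f, id_f, id_comp, id_comp,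
      ← cancel_mono ((L.stupidTruncXIso (ComplexShape.embeddingUpIntLE d) hi).hom), Category.assoc, Category.assoc,
      Category.assoc, stupidTruncMap_stupidTruncXIso_hom]
    simp [HomologicalComplex.stupidTruncXIso, HomologicalComplex.restrictionXIso]
  · exact (isZero_stupidTrunc_X_of_lt L d p (by omega)).eq_of_tgt _ _

/-- **Columns uniformly bounded below, arbitrarily many of them** («first quadrant»): let `φ : K ⟶ L` be a morphism of
bicomplexes whose columns vanish below `p₀` (`IsStrictlyGE p₀` as complexes of columns; NO upper bound on the number
of columns) and such that EVERY column of `K` and of `L` is concentrated in degrees `≥ a'` (one bound for all columns).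
If every column `φ.f p` is a quasi-isomorphism, `Tot(φ)` is a quasi-isomorphism. Proof, degree by degree: for the
homology in degree `n` only the columns `p ≤ d := n + 1 - a'` matter — the projections `K ⟶ σ^{≤ d} K`,
`L ⟶ σ^{≤ d} L` (Mathlib's stupid truncation `stupidTrunc` with `Embedding.liftExtend`) induce maps of total complexes
that are isomorphisms in degrees `≤ n + 1` (`isIso_total_map_f_of_isIso`), and `σ^{≤ d} K ⟶ σ^{≤ d} L` has finitely
many columns, so `Algebra/Homology/TotalQuasiIsoOfColumns.quasiIso_total_map_of_quasiIso_columns` applies. Without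
the uniform bound `a'` the statement fails. [cite: Weibel1994, 5.6.1–5.6.2 and 2.7.3] [cite: StacksProject, Tag 0133] -/
theorem quasiIso_total_map_of_quasiIso_columns_of_isStrictlyGE
    (K L : HomologicalComplex₂ C (ComplexShape.up ℤ) (ComplexShape.up ℤ)) (φ : K ⟶ L) (p₀ a' : ℤ)
    [CochainComplex.IsStrictlyGE K p₀] [CochainComplex.IsStrictlyGE L p₀]
    (hK : ∀ p : ℤ, CochainComplex.IsStrictlyGE (K.X p) a') (hL : ∀ p : ℤ, CochainComplex.IsStrictlyGE (L.X p) a')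
    (hφ : ∀ p, QuasiIso (φ.f p)) : QuasiIso (HomologicalComplex₂.total.map φ (ComplexShape.up ℤ)) := by
  rw [quasiIso_iff]
  intro n
  -- cut the columns beyond `d`
  let d : ℤ := n + 1 - a'
  let e := ComplexShape.embeddingUpIntLE d
  let πK : K ⟶ K.stupidTrunc e := e.liftExtend (𝟙 (K.restriction e)) (hasLift_id_restriction K d)
  let πL : L ⟶ L.stupidTrunc e := e.liftExtend (𝟙 (L.restriction e)) (hasLift_id_restriction L d)
  -- the truncated morphism has finitely many columns, all quasi-isomorphisms
  have hφ' : ∀ p, QuasiIso ((stupidTruncMap φ e).f p) := fun p => by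
    by_cases hp : p ≤ d
    · have hi : e.f (d - p).toNat = p := by simp [e]; omega
      haveI := hφ p
      exact quasiIso_of_arrow_mk_iso (φ.f p) _
        (Arrow.isoMk (K.stupidTruncXIso e hi).symm (L.stupidTruncXIso e hi).symm (by
          change (K.stupidTruncXIso e hi).inv ≫ (stupidTruncMap φ e).f p = φ.f p ≫ (L.stupidTruncXIso e hi).inv
          rw [Iso.inv_comp_eq, ← Category.assoc, Iso.eq_comp_inv, stupidTruncMap_stupidTruncXIso_hom]))
    · exact quasiIso_of_isZero _ (isZero_stupidTrunc_X_of_lt K d p (by omega))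
        (isZero_stupidTrunc_X_of_lt L d p (by omega))
  haveI hq : QuasiIso (HomologicalComplex₂.total.map (stupidTruncMap φ e) (ComplexShape.up ℤ)) :=
    quasiIso_total_map_of_quasiIso_columns _ _ _ p₀ d hφ'
  -- the projections are isomorphisms on total complexes in degrees `≤ n + 1`
  have hπ : ∀ (M : HomologicalComplex₂ C (ComplexShape.up ℤ) (ComplexShape.up ℤ))
      (hM : ∀ p : ℤ, CochainComplex.IsStrictlyGE (M.X p) a') (m : ℤ), m ≤ n + 1 →
      IsIso ((HomologicalComplex₂.total.map (e.liftExtend (𝟙 (M.restriction e)) (hasLift_id_restriction M d))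
        (ComplexShape.up ℤ)).f m) := fun M hM m hm => by
    refine isIso_total_map_f_of_isIso _ m fun p q hpq => ?_
    by_cases hp : p ≤ d
    · haveI := isIso_liftExtend_id_f M d p hp
      infer_instance
    · haveI := hM p
      -- a morphism between zero objects is an isomorphism
      exact ⟨⟨0, (CochainComplex.isZero_of_isStrictlyGE (M.X p) a' q (by omega)).eq_of_src _ _,
        (isZero_X_X_of_isZero_X _ (isZero_stupidTrunc_X_of_lt M d p (by omega)) q).eq_of_src _ _⟩⟩
  haveI : QuasiIsoAt (HomologicalComplex₂.total.map πK (ComplexShape.up ℤ)) n :=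
    quasiIsoAt_of_isIso_f _ n (hπ K hK _ (by omega)) (hπ K hK _ (by omega)) (hπ K hK _ le_rfl)
  haveI : QuasiIsoAt (HomologicalComplex₂.total.map πL (ComplexShape.up ℤ)) n :=
    quasiIsoAt_of_isIso_f _ n (hπ L hL _ (by omega)) (hπ L hL _ (by omega)) (hπ L hL _ le_rfl)
  haveI : QuasiIsoAt (HomologicalComplex₂.total.map (stupidTruncMap φ e) (ComplexShape.up ℤ)) n := inferInstance
  exact quasiIsoAt_of_square _ (HomologicalComplex₂.total.map (stupidTruncMap φ e) (ComplexShape.up ℤ))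
    (HomologicalComplex₂.total.map πK (ComplexShape.up ℤ)) (HomologicalComplex₂.total.map πL (ComplexShape.up ℤ))
    (by rw [← HomologicalComplex₂.total.map_comp, ← HomologicalComplex₂.total.map_comp, liftExtend_id_naturality]) n

/-! ### §3 Rows: the flipped statement -/

/-- **`Tot` commutes with flipping**, naturally: Mathlib's `totalFlipIso` is natural in the bicomplex. Stated for
any morphism `φ' : K.flip ⟶ L.flip` with the components of `φ` transposed (e.g. `(flipFunctor C _ _).map φ`).
[cite: Weibel1994, 1.2.6 (total complex)] -/
theorem total_map_flip_comm {K L : HomologicalComplex₂ C (ComplexShape.up ℤ) (ComplexShape.up ℤ)} (φ : K ⟶ L)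
    (φ' : K.flip ⟶ L.flip) (hφ' : ∀ q p : ℤ, (φ'.f q).f p = (φ.f p).f q) :
    HomologicalComplex₂.total.map φ' (ComplexShape.up ℤ) ≫ (L.totalFlipIso (ComplexShape.up ℤ)).hom =
      (K.totalFlipIso (ComplexShape.up ℤ)).hom ≫ HomologicalComplex₂.total.map φ (ComplexShape.up ℤ) := by
  ext j : 1
  refine HomologicalComplex₂.total.hom_ext _ fun q p h => ?_
  rw [comp_f, comp_f, HomologicalComplex₂.ιTotal_map_assoc, hφ', HomologicalComplex₂.ιTotal_totalFlipIso_f_hom,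
    HomologicalComplex₂.ιTotal_totalFlipIso_f_hom_assoc, Linear.comp_units_smul, Linear.units_smul_comp,
    HomologicalComplex₂.ιTotal_map]

/-- `Tot(flip φ)` is a quasi-isomorphism iff `Tot(φ)` is. [cite: Weibel1994, 1.2.6] -/
theorem quasiIso_total_map_flip_iff {K L : HomologicalComplex₂ C (ComplexShape.up ℤ) (ComplexShape.up ℤ)} (φ : K ⟶ L)
    (φ' : K.flip ⟶ L.flip) (hφ' : ∀ q p : ℤ, (φ'.f q).f p = (φ.f p).f q) :
    QuasiIso (HomologicalComplex₂.total.map φ' (ComplexShape.up ℤ)) ↔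
      QuasiIso (HomologicalComplex₂.total.map φ (ComplexShape.up ℤ)) := by
  let e : Arrow.mk (HomologicalComplex₂.total.map φ' (ComplexShape.up ℤ)) ≅
      Arrow.mk (HomologicalComplex₂.total.map φ (ComplexShape.up ℤ)) :=
    Arrow.isoMk (K.totalFlipIso (ComplexShape.up ℤ)) (L.totalFlipIso (ComplexShape.up ℤ))
      (total_map_flip_comm φ φ' hφ').symm
  exact ⟨fun h => quasiIso_of_arrow_mk_iso _ _ e, fun h => quasiIso_of_arrow_mk_iso _ _ e.symm⟩

omit [∀ K : HomologicalComplex₂ C (ComplexShape.up ℤ) (ComplexShape.up ℤ), K.HasTotal (ComplexShape.up ℤ)] in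
/-- A bicomplex all of whose columns are concentrated in degrees `≥ a'` has no ROWS below `a'` (its flip is
`IsStrictlyGE a'` as a complex of rows). [cite: Weibel1994, 1.2.6] -/
theorem isStrictlyGE_flip (K : HomologicalComplex₂ C (ComplexShape.up ℤ) (ComplexShape.up ℤ)) (a' : ℤ)
    (hK : ∀ p : ℤ, CochainComplex.IsStrictlyGE (K.X p) a') : CochainComplex.IsStrictlyGE K.flip a' := by
  rw [CochainComplex.isStrictlyGE_iff]
  intro q hq
  rw [IsZero.iff_id_eq_zero]
  ext p
  haveI := hK p
  exact (CochainComplex.isZero_of_isStrictlyGE (K.X p) a' q hq).eq_of_src _ _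

omit [∀ K : HomologicalComplex₂ C (ComplexShape.up ℤ) (ComplexShape.up ℤ), K.HasTotal (ComplexShape.up ℤ)] in
/-- The rows of a bicomplex with no columns below `p₀` are concentrated in degrees `≥ p₀`. [cite: Weibel1994, 1.2.6] -/
theorem isStrictlyGE_flip_X (K : HomologicalComplex₂ C (ComplexShape.up ℤ) (ComplexShape.up ℤ)) (p₀ : ℤ)
    [CochainComplex.IsStrictlyGE K p₀] (q : ℤ) : CochainComplex.IsStrictlyGE (K.flip.X q) p₀ := by
  rw [CochainComplex.isStrictlyGE_iff]
  intro p hp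
  exact isZero_X_X_of_isZero_X K (CochainComplex.isZero_of_isStrictlyGE K p₀ p hp) q

/-- **Row-wise quasi-isomorphisms of first-quadrant bicomplexes induce quasi-isomorphisms of total complexes**: let
`φ : K ⟶ L` be a morphism of bicomplexes with no columns below `p₀` and all columns concentrated in degrees `≥ a'`
(the same «first quadrant» hypotheses as `quasiIso_total_map_of_quasiIso_columns_of_isStrictlyGE`); if every ROW
`(flip φ).f q : K^{•,q} ⟶ L^{•,q}` is a quasi-isomorphism, then `Tot(φ)` is a quasi-isomorphism (flip, the column
statement, and the naturality of Mathlib's `totalFlipIso`). This is the form needed for the augmentation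
`I• → Tot Č(𝓤, I•)` of a Čech bicomplex with exact rows. [cite: Weibel1994, 5.6.1–5.6.2 and 2.7.3]
[cite: StacksProject, Tag 0133] -/
theorem quasiIso_total_map_of_quasiIso_rows_of_isStrictlyGE
    (K L : HomologicalComplex₂ C (ComplexShape.up ℤ) (ComplexShape.up ℤ)) (φ : K ⟶ L) (p₀ a' : ℤ)
    [CochainComplex.IsStrictlyGE K p₀] [CochainComplex.IsStrictlyGE L p₀]
    (hK : ∀ p : ℤ, CochainComplex.IsStrictlyGE (K.X p) a') (hL : ∀ p : ℤ, CochainComplex.IsStrictlyGE (L.X p) a')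
    (hφ : ∀ q, QuasiIso (((HomologicalComplex₂.flipFunctor C (ComplexShape.up ℤ) (ComplexShape.up ℤ)).map φ).f q)) :
    QuasiIso (HomologicalComplex₂.total.map φ (ComplexShape.up ℤ)) := by
  haveI := isStrictlyGE_flip K a' hK
  haveI := isStrictlyGE_flip L a' hL
  rw [← quasiIso_total_map_flip_iff φ
    ((HomologicalComplex₂.flipFunctor C (ComplexShape.up ℤ) (ComplexShape.up ℤ)).map φ) (fun _ _ => rfl)]
  exact quasiIso_total_map_of_quasiIso_columns_of_isStrictlyGE K.flip L.flip _ a' p₀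
    (isStrictlyGE_flip_X K p₀) (isStrictlyGE_flip_X L p₀) hφ

end Literature.Algebra.Homology

end
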